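import Mathlib
import Summits.RiemannHypothesis.RiemannHypothesis.Theorems.MotivicDoorDualSonin

/-!
# Motivic door — the depth-∞ semilocal symbol at `S = {∞, p}` is unimodular, and fixed vectors of the
# semilocal unitary supported in the unit interval vanish (pub-rhdoor seat lad-3)

HONEST FRAMING (verbatim, governs every line below): lottery ticket at the motivic door; RH probability
negligible; consolation prizes are real: a new semi-local Weil-positivity theorem, or a located gap in
the Connes–Consani programme, plus the ff-door theorem.

CONTEXT (label DERIVED — prose, recorded in the cell's `pub-rhdoor-lad-3/LADDER-lad3.md` §B9; only the
two elementary anchors below are kernel-checked).  The depth-`J` corner kernel of the semilocal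
Connes–Consani mechanism at `S = {∞, p}`,
`k_J(x,y) = 2[(1 - 1/p) Σ_{k=0}^{J} cos(2π p^k x y) - (1/p) cos(2π x y / p)]` on `[0,1]²`,
is the compression `P m_J(δ_p) F_c P` of the cosine transform `F_c` (unitary on `L²(0,∞)`) composed
with a Laurent polynomial `m_J` in the unitary dilation `δ_p h(x) = p^{1/2} h(p x)`:
`m_J(z) = (1 - 1/p) Σ_{k ≤ J} p^{-k/2} z^k - p^{-1/2} z^{-1}`.  Since the `k`-th cosine block
`K_k = p^{-k/2} P δ_{p^k} F_c P` has `‖K_k‖ ≤ p^{-k/2}` (`δ_{p^k} F_c` is unitary; the decay is the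
prefactor carried by `m_J`, not the norm of `P δ_{p^k} F_c P`, which is `≤ 1`), the
series converges in OPERATOR NORM, the limit `T_S = P m(δ_p) F_c P` is compact self-adjoint, and its
symbol on the unit circle, with `w = p^{-1/2} z`, is
`m(z) = (1 - |w|²)/(1 - w) - conj w = (1 - conj w)/(1 - w)` — UNIMODULAR (`symbol_eq`, `norm_symbol_eq_one`
below; in the Mellin variable `z = p^{-it}` this is the ratio of local Euler factors
`(1 - p^{-(1/2 - it)})/(1 - p^{-(1/2 + it)})`, `norm_eulerRatio_eq_one`).  Hence `𝒰_S = m(δ_p) F_c` is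
unitary, `‖T_S‖ ≤ 1`, and an eigenvalue `±1` of `T_S` would be a vector `f` supported in `[0,1]` with
`𝒰_S f = ±f`; unwinding `m(δ_p) = (1 - p^{-1/2} δ_p)^{-1} (1 - p^{-1/2} δ_p^{-1})` gives the pointwise
relation `f x - f (p x) = ±(g x - g (x/p)/p)` with `g = F_c f` entire, and `f = 0` on `(1, ∞)` forces the
dual-Sonin dilation equation `g (p x) = g x / p` on `[1, ∞)`, whence `g = 0` and `f = 0`
(`eq_zero_of_fixed_relation` below, resting on `MotivicDoor.DualSonin.eq_zero_of_dilation_eq`).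
CONSEQUENCE (DERIVED): `spec T_S ⊂ (-1, 1)` — the top eigenvalue `μ₊(J) ↑ μ₊(∞) < 1` strictly (DATA:
`1 - μ₊(12) = 2.8e-3` at `p = 2`), the semilocal analogue of the prolate gap; while `T_S` is NOT
Hilbert–Schmidt (`‖k_J(1,·)‖² = (J+2)/2 → ∞`), which is the operator-theoretic form of the located gap
G1 (`ε_S′(1⁺) = +∞`).

DATA vs PROVED: every `theorem` in this file is PROVED (standard axioms); the two numbers quoted above
are DATA and appear only in this docstring.
-/

open Complex ComplexConjugate

namespace Summit.RiemannHypothesis.RiemannHypothesis.Theorems.MotivicDoor.SemilocalSymbol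

/-- The depth-∞ `p`-symbol identity: for `w ≠ 1`,
`(1 - |w|²)/(1 - w) - conj w = (1 - conj w)/(1 - w)`. -/
theorem symbol_eq (w : ℂ) (hw : w ≠ 1) :
    ((1 : ℂ) - (Complex.normSq w : ℂ)) / (1 - w) - conj w = (1 - conj w) / (1 - w) := by
  have h1 : (1 : ℂ) - w ≠ 0 := sub_ne_zero.mpr (Ne.symm hw)
  rw [Complex.normSq_eq_conj_mul_self, eq_div_iff h1, sub_mul, div_mul_cancel₀ _ h1]
  ring

/-- Unimodularity of the depth-∞ symbol inside the unit disc: `‖(1 - |w|²)/(1 - w) - conj w‖ = 1` for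
`‖w‖ < 1` (apply with `w = p^{-1/2} z`, `|z| = 1`). -/
theorem norm_symbol_eq_one (w : ℂ) (hw : ‖w‖ < 1) :
    ‖((1 : ℂ) - (Complex.normSq w : ℂ)) / (1 - w) - conj w‖ = 1 := by
  have hw1 : w ≠ 1 := by
    rintro rfl
    simp at hw
  have h1 : (1 : ℂ) - w ≠ 0 := sub_ne_zero.mpr (Ne.symm hw1)
  rw [symbol_eq w hw1, norm_div]
  have hc : ‖1 - conj w‖ = ‖1 - w‖ := by
    have : (1 : ℂ) - conj w = conj (1 - w) := by simp [map_sub, map_one]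
    rw [this, Complex.norm_conj]
  rw [hc, div_self (norm_ne_zero_iff.mpr h1)]

/-- The same unimodularity in the Mellin variable: on the critical line the ratio of local Euler
factors `(1 - p^{-(1/2 - it)})/(1 - p^{-(1/2 + it)})` has norm one (`1 < p`, `t` real). -/
theorem norm_eulerRatio_eq_one {p : ℝ} (hp : 1 < p) (t : ℝ) :
    ‖(1 - (p : ℂ) ^ (-(1 / 2 - t * I))) / (1 - (p : ℂ) ^ (-(1 / 2 + t * I)))‖ = 1 := by
  have hp0 : (0 : ℝ) < p := by linarith
  -- the numerator is the complex conjugate of the denominator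
  have hconj : (1 : ℂ) - (p : ℂ) ^ (-(1 / 2 - t * I)) = conj (1 - (p : ℂ) ^ (-(1 / 2 + t * I))) := by
    have harg : (p : ℂ).arg ≠ Real.pi := by
      rw [Complex.arg_ofReal_of_nonneg hp0.le]
      exact (ne_of_lt Real.pi_pos)
    have hc : conj ((p : ℂ) ^ (-(1 / 2 + t * I))) = (p : ℂ) ^ (-(1 / 2 - t * I)) := by
      have h := Complex.cpow_conj (p : ℂ) (-(1 / 2 + t * I)) harg
      -- h : (p:ℂ) ^ conj (-(1/2 + t I)) = conj (conj (p:ℂ) ^ (-(1/2 + t I)))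
      rw [Complex.conj_ofReal] at h
      have hs : conj (-(1 / 2 + (t : ℂ) * I)) = -(1 / 2 - (t : ℂ) * I) := by
        simp [map_neg, map_add, map_mul, Complex.conj_I, Complex.conj_ofReal, sub_eq_add_neg]
        norm_num [map_ofNat]
      rw [hs] at h
      exact h.symm
    rw [map_sub, map_one, hc]
  have hden : (1 : ℂ) - (p : ℂ) ^ (-(1 / 2 + t * I)) ≠ 0 := by
    intro h0
    have hn : ‖(p : ℂ) ^ (-(1 / 2 + t * I))‖ = p ^ (-(1 / 2 : ℝ)) := by
      rw [Complex.norm_cpow_eq_rpow_re_of_pos hp0]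
      congr 1
      simp
    have hlt : (p : ℝ) ^ (-(1 / 2 : ℝ)) < 1 :=
      Real.rpow_lt_one_of_one_lt_of_neg hp (by norm_num)
    have : ‖(p : ℂ) ^ (-(1 / 2 + t * I))‖ = 1 := by
      have := sub_eq_zero.mp h0
      rw [← this, norm_one]
    linarith [hn ▸ this]
  rw [hconj, norm_div, Complex.norm_conj, div_self (norm_ne_zero_iff.mpr hden)]

/-- Fixed (or anti-fixed) vectors of the semilocal unitary supported in the unit interval vanish —
pointwise form of the reduction: if `f x - f (p x) = g x - g (x/p)/p` for `x > 0`, `f = 0` on `(1, ∞)`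
and `g` is real-analytic on `ℝ`, then `g = 0` and `f = 0` on `(0, ∞)`.  (For the anti-fixed case apply
it to `-g`.)  The analytic input is `MotivicDoor.DualSonin.eq_zero_of_dilation_eq`. -/
theorem eq_zero_of_fixed_relation {p : ℝ} (hp : 1 < p) {f g : ℝ → ℂ}
    (hg : AnalyticOnNhd ℝ g Set.univ)
    (hrel : ∀ x : ℝ, 0 < x → f x - f (p * x) = g x - g (x / p) / (p : ℂ))
    (hf : ∀ x : ℝ, 1 < x → f x = 0) :
    g = 0 ∧ ∀ x : ℝ, 0 < x → f x = 0 := by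
  have hp0 : (0 : ℝ) < p := by linarith
  have hpne : (p : ℝ) ≠ 0 := ne_of_gt hp0
  -- the dual-Sonin dilation equation for `g` on `[1, ∞)`
  have hdil : ∀ x : ℝ, 1 ≤ x → g (p * x) = g x / (p : ℂ) := by
    intro x hx
    have hx0 : 0 < p * x := by positivity
    have h1 : 1 < p * x := by nlinarith
    have h2 : 1 < p * (p * x) := by nlinarith
    have h := hrel (p * x) hx0
    rw [hf _ h1, hf _ h2, mul_div_cancel_left₀ x hpne, sub_self] at h
    -- h : 0 = g (p * x) - g x / p
    exact (sub_eq_zero.mp h.symm)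
  have hg0 : g = 0 := DualSonin.eq_zero_of_dilation_eq hp hg hdil
  refine ⟨hg0, ?_⟩
  have hstep : ∀ x : ℝ, 0 < x → f x = f (p * x) := by
    intro x hx
    have h := hrel x hx
    rw [hg0] at h
    simp only [Pi.zero_apply, zero_div, sub_self] at h
    exact sub_eq_zero.mp h
  have hiter : ∀ n : ℕ, ∀ x : ℝ, 0 < x → f x = f (p ^ n * x) := by
    intro n
    induction n with
    | zero => intro x _; simp
    | succ n ih =>
        intro x hx
        rw [ih x hx, hstep _ (by positivity)]
        congr 1
        ring
  intro x hx
  obtain ⟨n, hn⟩ := pow_unbounded_of_one_lt (1 / x) hp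
  rw [hiter n x hx]
  apply hf
  rw [div_lt_iff₀ hx] at hn
  linarith

end Summit.RiemannHypothesis.RiemannHypothesis.Theorems.MotivicDoor.SemilocalSymbol
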